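import Summits.AtomisticToContinuum.Crystallization.Theorems.SlackRigidity.Negative.WitnessTransitive

/-!
# `SlackRigidity` (stmt-AtomisticToContinuum-11960), negative side III: the isometry `A` is load-bearing

Continuation of `WitnessBasics.lean` / `WitnessTransitive.lean` (same namespace): with the matching isometry
frozen to the identity the statement fails for EVERY periodic `P` (`not_rigidForWithoutRotations`):
reflected ground states are ground states, so a witness would contain whole spheres.  All `[folklore]`.
-/



noncomputable section

open scoped BigOperators Topology
open Filter Set Metric

namespace Summit.AtomisticToContinuum.Crystallization.Theorems.SlackRigidityNegative

open Literature.MathematicalPhysics.StatisticalMechanics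
open Summit.AtomisticToContinuum.Crystallization.Theses.ThreeConeCertificate (SlackRigidity)


/-! ## § Load-bearing hypotheses (continued): the isometry `A` -/

/-- Translation-only matching: the crux's predicate with the isometry frozen to `A = 1`. [folklore] -/
def GoodT (P : PeriodicConfiguration 3) (R ε : ℝ) {N : ℕ} (x : Fin N → E3) (i : Fin N) : Prop :=
  (∀ p ∈ P.points, ‖p‖ ≤ R → ∃ j : Fin N, dist (x j) (x i + p) ≤ ε) ∧
    (∀ j : Fin N, dist (x j) (x i) ≤ R → ∃ p ∈ P.points, dist (x j) (x i + p) ≤ ε)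

/-- The crux's inner statement for a witness `P` WITHOUT ROTATIONS (environments must match `P`
in a fixed orientation). [folklore] -/
def RigidForWithoutRotations (P : PeriodicConfiguration 3) : Prop :=
  ∀ R ε : ℝ, 0 < R → 0 < ε → ∀ x : (N : ℕ) → Fin N → E3,
    (∀ N, Function.Injective (x N)) → ExcessVanishes x → FewBad fun N i => GoodT P R ε (x N) i

/-- Every periodic configuration has a non-zero point. [folklore] -/
theorem exists_ne_zero_mem_points' (P : PeriodicConfiguration 3) : ∃ p ∈ P.points, p ≠ 0 := by
  by_cases h0 : (0 : E3) ∈ P.points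
  · exact exists_ne_zero_mem_points P h0
  · obtain ⟨y, hy⟩ := P.points_nonempty
    exact ⟨y, hy, fun h => h0 (h ▸ hy)⟩

/-- **`_false_without_` (rotations).** With `A` frozen to the identity the statement fails for
EVERY `P`: reflecting a ground-state sequence is again a ground-state sequence, and a particle
good for both forces every point of the sphere `‖q‖ = ‖p‖` (`p ∈ P.points ∖ 0`) into the closed,
locally finite set `P.points` — but that sphere is infinite. Any proof must let `A` depend on the
particle (rotational covariance of near-minimisers is real: grains, twins). [folklore] -/
theorem not_rigidForWithoutRotations (P : PeriodicConfiguration 3) :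
    ¬ RigidForWithoutRotations P := by
  intro hP
  obtain ⟨p, hp, hp0⟩ := exists_ne_zero_mem_points' P
  have hpn : 0 < ‖p‖ := norm_pos_iff.2 hp0
  have hsphere : sphere (0 : E3) ‖p‖ ⊆ P.points := by
    intro q hq
    rw [mem_sphere_zero_iff_norm] at hq
    have happrox : ∀ ε : ℝ, 0 < ε → ε ≤ 1 → ∃ p' ∈ P.points, dist p' q ≤ 2 * ε := by
      intro ε hε hε1
      obtain ⟨B, hB⟩ : ∃ B : E3 ≃ₗᵢ[ℝ] E3, B q = p :=
        ⟨Submodule.reflection (ℝ ∙ (q - p))ᗮ, Submodule.reflection_sub hq⟩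
      set x' : (N : ℕ) → Fin N → E3 := fun N i => B (gs N i) with hx'
      have hgs' : ∀ N, IsGroundState lennardJones (x' N) := fun N =>
        (isGroundState_comp_isometry_iff lennardJones B.isometry).2 (gs_isGroundState N)
      have h1 := hP (‖p‖ + 1) ε (by linarith) hε gs gs_injective excessVanishes_gs
      have h2 := hP (‖p‖ + 1) ε (by linarith) hε x' (fun N => (hgs' N).1)
        (excessVanishes_of_isGroundState hgs')
      obtain ⟨N, i, ⟨-, hb1⟩, ⟨ha2, -⟩⟩ := (FewBad.eventually_exists_good_good h1 h2).exists
      obtain ⟨j, hj⟩ := ha2 p hp (by linarith)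
      change dist (B (gs N j)) (B (gs N i) + p) ≤ ε at hj
      have hj' : dist (gs N j) (gs N i + q) ≤ ε := by
        rw [← hB, ← map_add, B.dist_map] at hj
        exact hj
      have hji : dist (gs N j) (gs N i) ≤ ‖p‖ + 1 :=
        calc dist (gs N j) (gs N i)
            ≤ dist (gs N j) (gs N i + q) + dist (gs N i + q) (gs N i) := dist_triangle _ _ _
          _ ≤ ε + ‖q‖ := by rw [dist_eq_norm (gs N i + q), add_sub_cancel_left]; linarith
          _ ≤ ‖p‖ + 1 := by rw [hq]; linarith
      obtain ⟨p', hp', hjp'⟩ := hb1 j hji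
      refine ⟨p', hp', ?_⟩
      calc dist p' q = dist (gs N i + p') (gs N i + q) := (dist_add_left _ _ _).symm
        _ ≤ dist (gs N i + p') (gs N j) + dist (gs N j) (gs N i + q) := dist_triangle _ _ _
        _ ≤ ε + ε := by rw [dist_comm] at hjp'; linarith
        _ = 2 * ε := by ring
    have hfin : (closedBall (0 : E3) (‖p‖ + 2) ∩ P.points).Finite :=
      P.finite_inter_points isBounded_closedBall
    have hmem : q ∈ closure (closedBall (0 : E3) (‖p‖ + 2) ∩ P.points) := by
      rw [Metric.mem_closure_iff]
      intro η hη
      obtain ⟨ε, hε, hε1, hεη⟩ : ∃ ε : ℝ, 0 < ε ∧ ε ≤ 1 ∧ 2 * ε < η :=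
        ⟨min (η / 4) 1, lt_min (by linarith) one_pos, min_le_right _ _,
          by linarith [min_le_left (η / 4) (1 : ℝ)]⟩
      obtain ⟨p', hp', hd⟩ := happrox ε hε hε1
      refine ⟨p', ⟨?_, hp'⟩, ?_⟩
      · rw [mem_closedBall, dist_zero_right]
        calc ‖p'‖ = ‖(p' - q) + q‖ := by rw [sub_add_cancel]
          _ ≤ ‖p' - q‖ + ‖q‖ := norm_add_le _ _
          _ = dist p' q + ‖p‖ := by rw [dist_eq_norm, hq]
          _ ≤ ‖p‖ + 2 := by linarith
      · rw [dist_comm]; linarith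
    rw [hfin.isClosed.closure_eq] at hmem
    exact hmem.2
  have hinf : (sphere (0 : E3) ‖p‖).Infinite := by
    refine (isPreconnected_sphere ?_ (0 : E3) ‖p‖).infinite_of_nontrivial ?_
    · rw [← Module.finrank_eq_rank, finrank_euclideanSpace_fin]
      norm_num
    · refine ⟨p, by simp, -p, by simp, fun h => ?_⟩
      have h2 : (2 : ℝ) • p = 0 := by
        rw [two_smul]
        nth_rewrite 2 [h]
        exact add_neg_cancel p
      rw [smul_eq_zero] at h2
      norm_num at h2
      exact hp0 h2
  have hfin : (closedBall (0 : E3) ‖p‖ ∩ P.points).Finite := P.finite_inter_points isBounded_closedBall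
  exact hinf (hfin.subset fun q hq => ⟨sphere_subset_closedBall hq, hsphere hq⟩)

/-- Hence no periodic configuration at all satisfies the rotation-free version. [folklore] -/
theorem not_exists_rigidForWithoutRotations :
    ¬ ∃ P : PeriodicConfiguration 3, RigidForWithoutRotations P :=
  fun ⟨P, hP⟩ => not_rigidForWithoutRotations P hP

end Summit.AtomisticToContinuum.Crystallization.Theorems.SlackRigidityNegative

end
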